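/-
Copyright (c) 2026 the pub-hodgecm-mathlib formalisation cell (harness21).  Prover seat hodgecm-mathlib-K2E1-p13 (g4), Track B ∕ K2-LIT, h413 = `stmt-HodgeConjecture-24833`,
R90-TF section S8 «ContSpec-n½», #2 chain (G side), deal S8-R67 (1) of R90-CS-plan (g2): the letter (E_blk,₃) of F1 ★ `R90S8ResGLeClosureOfLettersU3` at K2E1-p11's ★ G-DEFS
`R90S8ResGBlockDataU3Defs` (regime R1) — the N = 3 twin of ★ `R90S8PseudoEisensteinBlocksDenseU2` ED. 2, by the same Hilbert-space lemma.
-/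
import Summits.HodgeConjecture.HodgeConjecture.Theorems.R90S8ResGBlockDataU3Defs          -- ★ p862621 (K2E1-p11): `resGBlock` ∕ `resGAtom` ∕ `resGAtomTop` ∕ `resGAtomMid` ∕ `resGLine` (regime R1) + read-backs
import Summits.HodgeConjecture.HodgeConjecture.Theorems.R90S8PseudoEisensteinBlocksDenseU2    -- ★ p862438∕p862525 (this seat): §1 `le_topologicalClosure_sup_inf_orthogonal` (Mathlib-only Hilbert-space lemma)
import HarnessLib

/-!
# S8 #2 chain — `R90S8PseudoEisensteinBlocksDenseU3`: the letter (E_blk,₃) «`resGBlock ≤ closure (resGAtom U ⊔ resGLine U)`» of F1 ★ `residualG_le_topologicalClosure_of_letters`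
# at the G-side defs of record (regime R1), for EVERY block-model map `U`, EVERY level datum `(K′, ω)` and EVERY Borel pair datum `(χ₁, χ₂)` of `U_{L∕L⁺}(3)`

Track B ∕ K2-LIT, crux h413 = `stmt-HodgeConjecture-24833`, route of record `HCCMUnconditional`; cell `hodgecm-mathlib`, R90-TF programme, section S8 «ContSpec-n½», socket #2
`sock_S8_res_classification` of `Lines/R90_S8_ResidualSpectrumU3B.lean` (ED. 4 :205), G-side letter chain (S8-R35 (2), S8-R56, S8-R67).  THEOREMS ONLY (no `def`, no `instance`, no
`notation`, no named-fact hypothesis, no `sorry`; default heartbeats); lane `--supports stmt-HodgeConjecture-24833 --as helper` (count-neutral).  CLOSES NO SOCKET: it pays ONE letter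
(`hEblk : ∀ i b, Blk i b ≤ (At i b ⊔ Ln i b).topologicalClosure`, ★ F1 :91) at `Blk := resGBlock`, `At := resGAtom U`, `Ln := resGLine U` (K2E1-p11's ★ D1–D3).

THE MATHEMATICS ([MoeglinWaldspurger1995] II.2.4, VI.2; [Langlands1976] §7; [Rogawski1990] §13.9 p. 229).  `G = U(Φ₃) = quasiSplit L⁺ L c 3`; the `(K′, ω)`-block of the Borel pair
datum `(χ₁, χ₂)` is the closed span `Sc` of the C⁰-bricks `[E(f(H)·φ)]`, `φ ∈ V(χ₁, χ₂; K′, ω)` (★ `resGBlock`); in the regime of record R1 the atoms are `At(U) := Sc ⊓ ker (snd ∘ U)`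
(top × middle residues: `z = 2` character lines, `z = 3∕2` `πⁿ(ξ)`-blocks) and the lines `Ln(U) := Sc ⊓ At(U)ᗮ` for a three-slot block-model map `U : L² →ₗ (A × M) × Λ`.  Then
(E_blk,₃) is the Hilbert-space lemma ★ `le_topologicalClosure_sup_inf_orthogonal` (`K` closed, `A ≤ K` ⇒ `K ≤ closure (A ⊔ (K ⊓ Aᗮ))`, no finite-dimensionality) at `K := resGBlock`
(★ `isClosed_resGBlock`), `A := resGAtom U` (★ `resGAtom_le_resGBlock`) — VERBATIM the N = 2 argument of ★ `R90S8PseudoEisensteinBlocksDenseU2` ED. 2.  HONEST SCOPE: the identification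
of `resGLine` with the unitary-axis wave-packet closure [MW95 VI.2] is NOT claimed (regime R1; socket #2 does not use it).
* §1 **`resGBlock_le_topologicalClosure_resGAtom_sup_resGLine`** (the clause), `topologicalClosure_resGAtom_sup_resGLine_eq` (`= resGBlock`), and for the assembly in ONE TERM
  **`hEblk_resGAtom_resGLine`** (F1's `hEblk` binder shape over an index family `i : ι`, `b : β i`).
HONEST LABEL: HC_CM is proved only modulo the 7 printed citations (2 remaining named inputs: hLiu418 = `stmt-HodgeConjecture-24832`, h413 = `stmt-HodgeConjecture-24833`) until rung 0
closes; REL ≠ ★ ≠ BUILT; this file asserts no named fact and closes no socket; count-neutral.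

## References
* [MoeglinWaldspurger1995] C. Mœglin, J.-L. Waldspurger, *Spectral Decomposition and Eisenstein Series* (1995), II.2.4, V.3.13, VI.2.
* [Langlands1976] R. P. Langlands, *On the Functional Equations Satisfied by Eisenstein Series*, LNM 544 (1976), §7.
* [Rogawski1990] J. D. Rogawski, *Automorphic Representations of Unitary Groups in Three Variables* (1990), §13.9 p. 229.
* [ReedSimonI1980] M. Reed, B. Simon, *Methods of Modern Mathematical Physics I* (1980), Thm. II.3.
-/

set_option autoImplicit false
set_option linter.dupNamespace false  -- the mandated namespace `…HodgeConjecture.HodgeConjecture.R90.S8` repeats the summit's segment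

noncomputable section

open MeasureTheory Measure Set Filter Topology NumberField
open Literature.NumberTheory.Automorphic Literature.NumberTheory.Automorphic.UnitaryGroup Literature.NumberTheory.GaloisRepresentations AdelicGroupData
open Literature.NumberTheory.Automorphic.Arthur2013.Leaves.TECR
open scoped ENNReal NNReal

namespace Summit.HodgeConjecture.HodgeConjecture.R90.S8

variable (L : Type) [Field L] [NumberField L] [IsCMField L]
  (μ : Measure (quasiSplit (↥(maximalRealSubfield L)) L (IsCMField.complexConj L) 3).automorphicQuotient)

/-! ## §1 (E_blk,₃) at the G-side defs of record -/

section ByName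

variable {A M Λ : Type*} [AddCommGroup A] [Module ℂ A] [AddCommGroup M] [Module ℂ M] [AddCommGroup Λ] [Module ℂ Λ]

/-- **(E_blk,₃) BY NAME — THE `(χ₁, χ₂)`-BLOCK OF PSEUDO-EISENSTEIN SERIES OF `U(Φ₃)` AT LEVEL `(K′, ω)` IS EXHAUSTED BY ITS ATOMS AND ITS LINES**: for ANY three-slot block-model map
`U : L² →ₗ[ℂ] (A × M) × Λ`, ANY level datum and ANY pair datum, `resGBlock ≤ closure (resGAtom U ⊔ resGLine U)` — ★ `le_topologicalClosure_sup_inf_orthogonal` at `K := resGBlock`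
(★ `isClosed_resGBlock`), `A := resGAtom U ≤ K` (★ `resGAtom_le_resGBlock`); `resGLine U = resGBlock ⊓ (resGAtom U)ᗮ` by definition (D3).  No side condition, no model letter.
[cite: MoeglinWaldspurger1995, II.2.4, VI.2] [cite: Langlands1976, §7] [cite: Rogawski1990, §13.9 p. 229] -/
theorem resGBlock_le_topologicalClosure_resGAtom_sup_resGLine (U : (quasiSplit (↥(maximalRealSubfield L)) L (IsCMField.complexConj L) 3).L2 μ →ₗ[ℂ] (A × M) × Λ)
    (K' : Subgroup (quasiSplit (↥(maximalRealSubfield L)) L (IsCMField.complexConj L) 3).Adelic) (ω : ↥K' →* ℂ)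
    (χ₁ : HeckeCharacter L) (χ₂ : ↥(TorusDict.torus (IsCMField.complexConj L)) →ₜ* ℂˣ) :
    resGBlock L μ K' ω χ₁ χ₂ ≤ (resGAtom L μ U K' ω χ₁ χ₂ ⊔ resGLine L μ U K' ω χ₁ χ₂).topologicalClosure :=
  le_topologicalClosure_sup_inf_orthogonal _ (isClosed_resGBlock L μ K' ω χ₁ χ₂) _ (resGAtom_le_resGBlock L μ U K' ω χ₁ χ₂)

/-- **… with equality**: `closure (resGAtom U ⊔ resGLine U) = resGBlock`. [cite: MoeglinWaldspurger1995, VI.2] -/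
theorem topologicalClosure_resGAtom_sup_resGLine_eq (U : (quasiSplit (↥(maximalRealSubfield L)) L (IsCMField.complexConj L) 3).L2 μ →ₗ[ℂ] (A × M) × Λ)
    (K' : Subgroup (quasiSplit (↥(maximalRealSubfield L)) L (IsCMField.complexConj L) 3).Adelic) (ω : ↥K' →* ℂ)
    (χ₁ : HeckeCharacter L) (χ₂ : ↥(TorusDict.torus (IsCMField.complexConj L)) →ₜ* ℂˣ) :
    (resGAtom L μ U K' ω χ₁ χ₂ ⊔ resGLine L μ U K' ω χ₁ χ₂).topologicalClosure = resGBlock L μ K' ω χ₁ χ₂ :=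
  topologicalClosure_sup_inf_orthogonal_eq _ (isClosed_resGBlock L μ K' ω χ₁ χ₂) _ (resGAtom_le_resGBlock L μ U K' ω χ₁ χ₂)

/-- **The in-block half of (O₃), free in regime R1**: `resGAtom U ⟂ resGLine U` (★ D3 read-back, restated at the pair for the assembly's convenience). [folklore] -/
theorem resGAtom_isOrtho_resGLine (U : (quasiSplit (↥(maximalRealSubfield L)) L (IsCMField.complexConj L) 3).L2 μ →ₗ[ℂ] (A × M) × Λ)
    (K' : Subgroup (quasiSplit (↥(maximalRealSubfield L)) L (IsCMField.complexConj L) 3).Adelic) (ω : ↥K' →* ℂ)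
    (χ₁ : HeckeCharacter L) (χ₂ : ↥(TorusDict.torus (IsCMField.complexConj L)) →ₜ* ℂˣ) :
    resGAtom L μ U K' ω χ₁ χ₂ ⟂ resGLine L μ U K' ω χ₁ χ₂ :=
  isOrtho_resGAtom_resGLine L μ U K' ω χ₁ χ₂

end ByName

/-- **F1's `hEblk` BINDER IN ONE TERM (E_blk,₃)** — for an index family `i : ι` of level data `(K' i, ω i)`, a block index `b : β i` with pair data `(χ₁ i b, χ₂ i b)`, and ANY family of
three-slot block-model maps `U i b : L² →ₗ[ℂ] (A i b × M i b) × Λ i b`:  `∀ i b, resGBlock … ≤ (resGAtom (U i b) … ⊔ resGLine (U i b) …).topologicalClosure` — the `hEblk` letter of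
★ `residualG_le_topologicalClosure_of_letters` at `Blk := fun i b => resGBlock L μ (K' i) (ω i) (χ₁ i b) (χ₂ i b)`, `At := fun i b => resGAtom L μ (U i b) …`, `Ln := fun i b => resGLine L μ (U i b) …`.
[cite: MoeglinWaldspurger1995, II.2.4, VI.2] [cite: Rogawski1990, §13.9 p. 229] -/
theorem hEblk_resGAtom_resGLine {ι : Type*} {β : ι → Type*} (K' : ι → Subgroup (quasiSplit (↥(maximalRealSubfield L)) L (IsCMField.complexConj L) 3).Adelic) (ω : ∀ i : ι, ↥(K' i) →* ℂ)
    (χ₁ : ∀ i : ι, β i → HeckeCharacter L) (χ₂ : ∀ i : ι, β i → (↥(TorusDict.torus (IsCMField.complexConj L)) →ₜ* ℂˣ))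
    {A M Λ : ∀ i : ι, β i → Type*} [∀ i b, AddCommGroup (A i b)] [∀ i b, Module ℂ (A i b)] [∀ i b, AddCommGroup (M i b)] [∀ i b, Module ℂ (M i b)]
    [∀ i b, AddCommGroup (Λ i b)] [∀ i b, Module ℂ (Λ i b)]
    (U : ∀ (i : ι) (b : β i), (quasiSplit (↥(maximalRealSubfield L)) L (IsCMField.complexConj L) 3).L2 μ →ₗ[ℂ] (A i b × M i b) × Λ i b) :
    ∀ (i : ι) (b : β i), resGBlock L μ (K' i) (ω i) (χ₁ i b) (χ₂ i b) ≤
      (resGAtom L μ (U i b) (K' i) (ω i) (χ₁ i b) (χ₂ i b) ⊔ resGLine L μ (U i b) (K' i) (ω i) (χ₁ i b) (χ₂ i b)).topologicalClosure :=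
  fun i b => resGBlock_le_topologicalClosure_resGAtom_sup_resGLine L μ (U i b) (K' i) (ω i) (χ₁ i b) (χ₂ i b)

end Summit.HodgeConjecture.HodgeConjecture.R90.S8

end
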